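import Literature.MathematicalPhysics.QuantumFieldTheory.Balaban1983to89.BlockAveragingFederbush
import Literature.MathematicalPhysics.QuantumFieldTheory.Balaban1983to89.MatrixNorms
import Literature.MathematicalPhysics.QuantumFieldTheory.Federbush1986.PureAveragesUNProp59
import Literature.MathematicalPhysics.QuantumFieldTheory.Federbush1986.PureAveragesSUNProp59

/-!
# B12 (0.10) «a definition which is equivalent to the one given by Federbush» — PROVED for `G = U(N)` and `G = SU(N)`:
# the tree's implicit (0.10) average `FederbushMean.fedM / federbushU / federbushSU` IS Federbush's pure average (1.2)

statement-level skeleton of published theorems with citation tags; proofs where landed; nothing here is a claim about the Yang–Mills mass gap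

CITATION HEADER (lean-in-tree rule).  lit-balaban cell (HOME `run/shared/lean/pub/lit-balaban/`), Phase-2 proof seat p32 (gen 9),
kind «bridge / knitting of two landed objects», SKELETON rows **B12.Eq0.10** (owner r09/r20; `proved-existing` = the CONSTRUCTION
`…Balaban1983to89.BlockAveragingFederbush`, p182931) × **F3.Eq1.1-1.2 / F3.Lem1.3 / F3.Prop5.9** (owner r17; statement file
`…Federbush1986.PureAverages` p238910, model instance `G = U(N)` `…PureAveragesUN*` p12 g6, `G = SU(N)` `…PureAveragesSUN*` p32 g8).
Nothing printed is re-typed here; no definition of either side is touched.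

THE PRINT.  T. Bałaban, *Renormalization group approach to lattice gauge field theories. I*, Commun. Math. Phys. **109** (1987)
249–301 [Balaban1987RG1], §0 p. 253 (render `…1987-cmp109-rg-I-small-field-p005-x2.png` of the cell `pub-balaban`, read as image):
*«There are several proposals how to define such averages, see [74, 75, 35]. Let us write a definition which is equivalent to the
one given by Federbush in [35]. The average of the set {U_j} is the element U ∈ Gᶜ such that U_j are in a small neighborhood of U,
and it satisfies the equation Σ_{j=1}^{n} (1/i) log U_j U⁻¹ = 0. (0.10) This definition has all the properties listed above, as it
was proved by Federbush in [35 (II)].»*  Reference [35 (II)] = P. Federbush, *A phase cell approach to Yang–Mills theory. III. Local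
stability, modified renormalization group transformation*, Commun. Math. Phys. **110** (1987) 293–309 [Federbush1987PhaseCellIII]
(University of Michigan preprint «II»; scan `run/shared/lean/pub/pub-balaban/t4/b2b-balaban-t4-lit2/pdf/fed1987-cmp110-III.pdf`),
§1 p. 294–295: *«we define an average ḡ = e^x (1.1) as the element minimizing the expression Σ_{i=1}^n d²(ḡ, g_i) (1.2)»*, Lemma 1.3
*«x = 0 ⇔ ΣA_i = 0»* p. 295, Proposition 5.9 (5.16) p. 301 (OCR `…/texts/fed1987-cmp110-III/p002–p003, p009`); and VI, Ann. Inst.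
H. Poincaré A **47** (1987) p. 19 [Federbush1987PhaseCellVI] *«yields « Balaban averaging. » (This definition actually differs slightly
from that used originally by Balaban.)»* (OCR `…/texts/fed1987-aihp47-VI/p004.txt`).

WHAT THE TREE HAD.  Two objects, on two carriers, with no theorem relating them (INTERFACES.md §4 l. 845, iface-2: «the bridge
`Lemma13` for (U(N), geodesic dist) ⇒ `fedSol` is the pure average is a Phase-2 lemma needing the Riemannian distance on U(N)
(not in tree)»):
* B12 side (`Balaban1983to89/BlockAveragingFederbush`, L²-operator norm `|·|` on `M_N(ℂ)`): the solution map of (0.10)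
  `FederbushMean.fedM δ U` on matrix families `U₀, …, U_m` all of whose quotients satisfy `|U_i U_k* − 1| < δ ≤ 1/100`
  (`sum_mlog_mul_star_fedM` = (0.10), `fedM_unique` = local uniqueness in `|M U₀* − 1| ≤ 2/25`), and the `Setup.GroupAverage`
  inhabitants `federbushU` (radius `1/100`) / `federbushSU` (radius `δ_N = min(1/100, 1/(3N))`) consumed by the cell's spine
  (`DrivenRuns.balaban`, `T4ApexPrinted`);
* F-III side (`Federbush1986/PureAveragesUN*`, p12 g6): the carrier `UN N` with the bi-invariant Riemannian LENGTH distance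
  (Frobenius metric `|A|² = −Tr A²` on `𝔲(N)`, (1.3)), the minimiser predicate `IsPureAverage` (1.2), Lemma 1.3 (⇒) in the form
  `UN.sum_mlog_rel_eq_zero_of_isPureAverage` (`Σ_i log(ḡ^* g_i) = 0`), Proposition 5.9 `UN.proposition59At_UN` (`ε₁ ≤ 10⁻⁴`) and
  `UN.existsUnique_isPureAverage`; and (p32 g8) `SUN N = {det = 1} ≤ UN N` with `SUN.isPureAverage_coe_of_pairwise`,
  `SUN.existsUnique_isPureAverage`.

WHAT IS PROVED HERE (Regime 1: families of pairwise length distance `< 10⁻⁴`; for `SU(N)` `< min(10⁻⁴, min(1/100, 1/(N+1))/8)`):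
* §1 norm plumbing between the two carriers: `|X|² ≤ Σ|X_ij|² = |X|_F²` (`opNorm_sq_le_sum` = the tree's
  `MatrixNorms.opNorm_sq_le_sum_norm_sq`, `frobNorm_sq_eq_sum` = `UNGauss.frob_norm_sq`), hence `|U^*V − 1| ≤ stepSize U V ≤ 2 d(U, V)`
  (`opNorm_rel_sub_one_le_stepSize`, `opNorm_mul_star_sub_one_le_two_mul_dist`) and the (0.10) guard `|U_i U_k* − 1| < δ` for
  families of pairwise distance `< r`, `2r ≤ δ` (`guard_of_dist_lt`);
* §2 **(1.2) ⇒ (0.10)**: every pure average `ḡ` of such a family solves Bałaban's equation IN BAŁABAN'S FORM `Σ_j log(U_j ḡ*) = 0`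
  (`sum_mlog_mul_star_eq_zero_of_isPureAverage`; Lemma 1.3 (⇒) + unitary conjugation `UNGauss.mlog_unitary_conj`) and lies in the
  uniqueness neighbourhood `|ḡ U₀* − 1| ≤ 2·10⁻⁴` (Proposition 5.9), HENCE **`ḡ = fedM δ U`** for every admissible guard
  (`val_eq_fedM_of_isPureAverage`);
* §3 **(0.10) ⇒ (1.2)**: `fedM δ U` IS a pure average (`isPureAverage_fedM`, existence by compactness `UN.exists_isPureAverage` + §2)
  and the equivalence of the two DEFINITIONS as printed — *minimiser of (1.2)* ⇔ *solution of (0.10) in a small neighbourhood of the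
  U_j* (`isPureAverage_iff_eq010`, `isPureAverage_iff_val_eq_fedM`);
* §4 group level: `federbushU.M U` is the (unique) pure average of the `U(N)`-family (`isPureAverage_federbushU`,
  `federbushU_eq_of_isPureAverage`; the guard `FamilySmall (1/100)` is automatic, `familySmall_federbushU_of_dist_lt`);
* §5 `SU(N)`: `federbushSU.M U` is the (unique) pure average IN `SU(N)` of an `SU(N)`-family (`isPureAverage_federbushSU`,
  `federbushSU_eq_of_isPureAverage`), via p32 g8's transfer `SUN.isPureAverage_coe_of_pairwise` and the `δ_N`-guard
  (`2·min(10⁻⁴, ρ_N/8) < min(1/100, 1/(3N))`).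
The carrier identifications are the obvious ones (`UN.ofUnitaryGroup` of p12; `toSUN` below, `val`-preserving); the two
`MulEquiv`s `equivUN : U(N) ≃* UN N`, `equivSUN : SU(N) ≃* SUN N` are recorded for consumers.

* §6 (v1.1) **VI p. 19 «This yields "Balaban averaging."»**: every admissible block-spin function `Φ` of Federbush's VI scheme on
  `U(N)` (r17's `UNBlockSpinFunction`, property 2): `Φ` returns a pure average on `ε`-small data) IS Bałaban's (0.10) average on
  data of size `< min(ε, 1/20000)`: `UNBlockSpinFunction.Φ_val_eq_fedM`, `UNBlockSpinFunction.Φ_eq_federbushU`; hence all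
  admissible `Φ` agree there (`UNBlockSpinFunction.Φ_eq_Φ`).

HONEST SCOPE.  Regime 1 only (numerical radii of the two files, not optimised); `log` = the series `MatrixLog.mlog` on both sides;
the distance on `U(N)`/`SU(N)` is p12's length distance of the Frobenius bi-invariant metric (on `SU(N)`: the restriction of the
`U(N)` distance, `SUN.dist_eq`).  Bałaban's `Gᶜ`-valued analytic extension of `M` is not touched (not in tree on either side).
No new `def … : Prop`; three small `def`s with bodies (`toSUN`, `equivUN`, `equivSUN`).
-/

namespace Literature.MathematicalPhysics.QuantumFieldTheory.Balaban1983to89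

namespace FederbushMean

open MatrixLog (mlog)
open Literature.MathematicalPhysics.QuantumFieldTheory.Federbush1986
open Literature.MathematicalPhysics.QuantumFieldTheory.Federbush1986.UNGauss (frob_norm_sq mlog_unitary_conj)

noncomputable section

variable {N : ℕ}

/-! ## §1 Norm plumbing: `|X| ≤ |X|_F`, the (0.10) guard from the length distance -/

section Norms

open scoped Matrix.Norms.L2Operator in
/-- **`|U^*V − 1| ≤ stepSize U V`**: Bałaban's operator-norm size of a step is at most Federbush's Frobenius size of it
(`UN.stepSize U V = |U^*V − 1|_F`; B7 (20) «|X| ≤ √N ‖X‖» with the UNnormalised Hilbert–Schmidt norm, i.e. `|X|² ≤ Σ_{ij}|X_{ij}|² =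
|X|_F²` — the tree's `MatrixNorms.opNorm_sq_le_sum_norm_sq` and `UNGauss.frob_norm_sq`, used by name). [cite: Balaban1985Averaging, (20) p.21]
[cite: Federbush1987PhaseCellIII, Lemma 1.0 (1.3) p. 295] -/
theorem opNorm_rel_sub_one_le_stepSize (U V : UN N) : ‖UN.rel U V - 1‖ ≤ UN.stepSize U V := by
  have h1 : ‖UN.rel U V - 1‖ ^ 2 ≤ ∑ i, ∑ j, ‖(UN.rel U V - 1) i j‖ ^ 2 := MatrixNorms.opNorm_sq_le_sum_norm_sq _
  have h2 : UN.stepSize U V ^ 2 = ∑ i, ∑ j, ‖(UN.rel U V - 1) i j‖ ^ 2 := by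
    rw [UN.stepSize_def]; exact frob_norm_sq _
  rw [← h2] at h1
  exact (pow_le_pow_iff_left₀ (norm_nonneg _) (UN.stepSize_nonneg U V) two_ne_zero).mp h1

open scoped Matrix.Norms.L2Operator in
/-- `|U^*V − 1| ≤ 2 d(U, V)` — the operator-norm step is controlled by the length distance (p12 `UN.stepSize_le_two_mul_distUN`).
[cite: Federbush1987PhaseCellIII, §1 p. 294] -/
theorem opNorm_rel_sub_one_le_two_mul_dist (U V : UN N) : ‖UN.rel U V - 1‖ ≤ 2 * dist U V :=
  (opNorm_rel_sub_one_le_stepSize U V).trans (UN.stepSize_le_two_mul_distUN U V)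

open scoped Matrix.Norms.L2Operator in
/-- `|U V* − 1| = |V^*U − 1|`: the (0.10) guard quotient and Federbush's relative position have the same operator-norm size
(conjugation by the unitary `V`). [cite: Balaban1987RG1, (0.10) p.253] -/
theorem opNorm_mul_star_sub_one_eq (U V : UN N) : ‖U.val * star V.val - 1‖ = ‖UN.rel V U - 1‖ := by
  have h : U.val * star V.val = V.val * UN.rel V U * star V.val := by
    rw [UN.rel_def, ← mul_assoc, UN.val_mul_star_val, one_mul]
  rw [h]
  exact ExpMeanLog.norm_conj_sub_one_eq V.mem (Federbush1986.UNGauss.star_mem_unitaryGroup' V.mem) (UN.val_mul_star_val V)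

open scoped Matrix.Norms.L2Operator in
/-- `|U V* − 1| ≤ 2 d(U, V)`. [cite: Balaban1987RG1, (0.10) p.253] -/
theorem opNorm_mul_star_sub_one_le_two_mul_dist (U V : UN N) : ‖U.val * star V.val - 1‖ ≤ 2 * dist U V := by
  rw [opNorm_mul_star_sub_one_eq, dist_comm]
  exact opNorm_rel_sub_one_le_two_mul_dist V U

open scoped Matrix.Norms.L2Operator in
/-- **The (0.10) guard from the length distance**: a `U(N)`-family of pairwise distance `< r` has all quotients
`|U_i U_k* − 1| < δ` as soon as `2r ≤ δ` («U_j are in a small neighborhood», p. 253). [cite: Balaban1987RG1, (0.10) p.253] -/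
theorem guard_of_dist_lt {m : ℕ} {U : Fin (m + 1) → UN N} {r δ : ℝ} (hclose : ∀ i k, dist (U i) (U k) < r) (hδ : 2 * r ≤ δ) :
    ∀ i k, ‖(U i).val * star (U k).val - 1‖ < δ := fun i k =>
  lt_of_le_of_lt (opNorm_mul_star_sub_one_le_two_mul_dist (U i) (U k)) (by linarith [hclose i k])

end Norms

/-! ## §2 (1.2) ⇒ (0.10): a pure average solves Bałaban's equation and IS `fedM` -/

section PureToBalaban

variable {m : ℕ} {U : Fin (m + 1) → UN N} {gbar : UN N}

/-- Proposition 5.9 in use: a pure average of a `10⁻⁴`-clustered family is `10⁻⁴`-close to every member.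
[cite: Federbush1987PhaseCellIII, Proposition 5.9 (5.16) p. 301] -/
theorem dist_lt_of_isPureAverage (hclose : ∀ i k, dist (U i) (U k) < 1 / 10000) (hbar : IsPureAverage U gbar) (i : Fin (m + 1)) :
    dist gbar (U i) < 1 / 10000 :=
  UN.proposition59At_UN (N := N) (ε₁ := 1 / 10000) le_rfl (m + 1) U gbar hbar hclose i

open scoped Matrix.Norms.Frobenius in
/-- **(1.2) ⇒ (0.10) in Bałaban's form**: a pure average `ḡ` of a `10⁻⁴`-clustered `U(N)`-family satisfies
`Σ_j log (U_j ḡ*) = 0` — Lemma 1.3 (⇒) at `ḡ` (p12 `UN.sum_mlog_rel_eq_zero_of_isPureAverage`: `Σ_j log(ḡ^*U_j) = 0`) conjugated by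
the unitary `ḡ` (`log(ḡ X ḡ^*) = ḡ (log X) ḡ^*`). [cite: Balaban1987RG1, (0.10) p.253]
[cite: Federbush1987PhaseCellIII, Lemma 1.3 (1.12) p. 295–296] -/
theorem sum_mlog_mul_star_eq_zero_of_isPureAverage (hclose : ∀ i k, dist (U i) (U k) < 1 / 10000)
    (hbar : IsPureAverage U gbar) : ∑ j, mlog ((U j).val * star gbar.val) = 0 := by
  have hstep : ∀ j, UN.stepSize gbar (U j) < 1 / 200 := fun j =>
    lt_of_le_of_lt (UN.stepSize_le_two_mul_distUN gbar (U j))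
      (by rw [← UN.dist_eq]; linarith [dist_lt_of_isPureAverage hclose hbar j])
  have hrel := UN.sum_mlog_rel_eq_zero_of_isPureAverage hstep hbar
  have hconj : ∀ j, mlog ((U j).val * star gbar.val) = gbar.val * mlog (UN.rel gbar (U j)) * star gbar.val := by
    intro j
    have hX : ‖UN.rel gbar (U j) - 1‖ < 1 := by
      rw [← UN.stepSize_def]; linarith [hstep j]
    have h := mlog_unitary_conj (Federbush1986.UNGauss.star_mem_unitaryGroup' gbar.mem) hX
    rw [star_star] at h
    rw [← h, UN.rel_def, ← mul_assoc, UN.val_mul_star_val, one_mul]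
  simp_rw [hconj, ← Finset.sum_mul, ← Finset.mul_sum, hrel, mul_zero, zero_mul]

open scoped Matrix.Norms.L2Operator in
/-- A pure average of a `10⁻⁴`-clustered family lies in the uniqueness neighbourhood of (0.10): `|ḡ U₀* − 1| ≤ 2·10⁻⁴ ≤ 2/25`.
[cite: Balaban1987RG1, (0.10) p.253] [cite: Federbush1987PhaseCellIII, Proposition 5.9 (5.16) p. 301] -/
theorem opNorm_mul_star_sub_one_le_of_isPureAverage (hclose : ∀ i k, dist (U i) (U k) < 1 / 10000)
    (hbar : IsPureAverage U gbar) : ‖gbar.val * star (U 0).val - 1‖ ≤ 2 / 10000 :=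
  (opNorm_mul_star_sub_one_le_two_mul_dist gbar (U 0)).trans (by linarith [dist_lt_of_isPureAverage hclose hbar 0])

open scoped Matrix.Norms.L2Operator in
/-- **Federbush's pure average IS Bałaban's (0.10) average**: for a `U(N)`-family `U₀, …, U_m` of pairwise length distance
`< 10⁻⁴` and any admissible guard (`|U_i U_k* − 1| < δ ≤ 1/100`), every minimiser `ḡ` of (1.2) equals `fedM δ U` — by the LOCAL
UNIQUENESS of the solution of (0.10) (`fedM_unique`) applied to §2's two facts. [cite: Balaban1987RG1, (0.10) p.253]
[cite: Federbush1987PhaseCellIII, (1.1)–(1.2) p. 294–295] -/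
theorem val_eq_fedM_of_isPureAverage {δ : ℝ} (hδ : δ ≤ 1 / 100) (hU : ∀ i k, ‖(U i).val * star (U k).val - 1‖ < δ)
    (hclose : ∀ i k, dist (U i) (U k) < 1 / 10000) (hbar : IsPureAverage U gbar) :
    gbar.val = fedM δ (fun j => (U j).val) :=
  fedM_unique (fun j => (U j).mem) hδ hU ((opNorm_mul_star_sub_one_le_of_isPureAverage hclose hbar).trans (by norm_num))
    (sum_mlog_mul_star_eq_zero_of_isPureAverage hclose hbar)

end PureToBalaban

/-! ## §3 (0.10) ⇒ (1.2): `fedM` is the pure average; the two definitions are equivalent -/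

section BalabanToPure

variable {m : ℕ} {U : Fin (m + 1) → UN N}

open scoped Matrix.Norms.L2Operator in
/-- **Bałaban's (0.10) average IS a Federbush pure average** (minimiser of (1.2)) of every `10⁻⁴`-clustered `U(N)`-family, for every
admissible guard: a minimiser exists (compactness of `U(N)`, `UN.exists_isPureAverage`) and equals `fedM δ U` by §2.
[cite: Balaban1987RG1, (0.10) p.253] [cite: Federbush1987PhaseCellIII, (1.1)–(1.2) p. 294–295] -/
theorem isPureAverage_fedM {δ : ℝ} (hδ : δ ≤ 1 / 100) (hU : ∀ i k, ‖(U i).val * star (U k).val - 1‖ < δ)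
    (hclose : ∀ i k, dist (U i) (U k) < 1 / 10000) :
    IsPureAverage U (UN.ofUnitaryGroup ⟨fedM δ (fun j => (U j).val), fedM_mem_unitaryGroup (fun j => (U j).mem) hδ⟩) := by
  obtain ⟨gbar, hbar⟩ := UN.exists_isPureAverage U
  have h := val_eq_fedM_of_isPureAverage hδ hU hclose hbar
  have e : UN.ofUnitaryGroup ⟨fedM δ (fun j => (U j).val), fedM_mem_unitaryGroup (fun j => (U j).mem) hδ⟩ = gbar :=
    UN.ext (by rw [h]; rfl)
  rw [e]; exact hbar

open scoped Matrix.Norms.L2Operator in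
/-- **The two definitions pick the same element**: `ḡ` minimises (1.2) iff `ḡ = fedM δ U` (as matrices), for `10⁻⁴`-clustered
`U(N)`-families and any admissible guard. [cite: Balaban1987RG1, (0.10) p.253] [cite: Federbush1987PhaseCellIII, (1.1)–(1.2) p. 294–295] -/
theorem isPureAverage_iff_val_eq_fedM {δ : ℝ} (hδ : δ ≤ 1 / 100) (hU : ∀ i k, ‖(U i).val * star (U k).val - 1‖ < δ)
    (hclose : ∀ i k, dist (U i) (U k) < 1 / 10000) (gbar : UN N) :
    IsPureAverage U gbar ↔ gbar.val = fedM δ (fun j => (U j).val) := by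
  refine ⟨val_eq_fedM_of_isPureAverage hδ hU hclose, fun h => ?_⟩
  have e : gbar = UN.ofUnitaryGroup ⟨fedM δ (fun j => (U j).val), fedM_mem_unitaryGroup (fun j => (U j).mem) hδ⟩ :=
    UN.ext (by rw [h]; rfl)
  rw [e]; exact isPureAverage_fedM hδ hU hclose

open scoped Matrix.Norms.L2Operator in
/-- **«a definition which is equivalent to the one given by Federbush»** (p. 253), AS PRINTED, for `G = U(N)` in Regime 1: for a
`U(N)`-family `U₀, …, U_m` of pairwise length distance `< 10⁻⁴`, an element `ḡ ∈ U(N)` MINIMISES `Σ_j d²(ḡ, U_j)` (Federbush (1.2))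
IFF «U_j are in a small neighborhood of ḡ» (`|ḡ U₀* − 1| ≤ 2/25`) «and it satisfies the equation Σ_j (1/i) log U_j ḡ⁻¹ = 0»
(Bałaban (0.10); `ḡ⁻¹ = ḡ*`, the factor `1/i` immaterial). [cite: Balaban1987RG1, (0.10) p.253]
[cite: Federbush1987PhaseCellIII, (1.1)–(1.2), Lemma 1.3 p. 294–296] -/
theorem isPureAverage_iff_eq010 (hclose : ∀ i k, dist (U i) (U k) < 1 / 10000) (gbar : UN N) :
    IsPureAverage U gbar ↔ ‖gbar.val * star (U 0).val - 1‖ ≤ 2 / 25 ∧ ∑ j, mlog ((U j).val * star gbar.val) = 0 := by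
  have hU : ∀ i k, ‖(U i).val * star (U k).val - 1‖ < 1 / 100 := guard_of_dist_lt hclose (by norm_num)
  refine ⟨fun hbar => ⟨(opNorm_mul_star_sub_one_le_of_isPureAverage hclose hbar).trans (by norm_num),
    sum_mlog_mul_star_eq_zero_of_isPureAverage hclose hbar⟩, fun h => ?_⟩
  have e : gbar.val = fedM (1 / 100) (fun j => (U j).val) := fedM_unique (fun j => (U j).mem) le_rfl hU h.1 h.2
  exact (isPureAverage_iff_val_eq_fedM le_rfl hU hclose gbar).mpr e

/-- Uniqueness transported: in Regime 1 the pure average of a `U(N)`-family is unique (p12 `UN.existsUnique_isPureAverage`), so ANY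
two admissible guards give the same `fedM`. [cite: Balaban1987RG1, (0.10)–(0.11) p.253] -/
theorem fedM_eq_fedM_of_dist_lt {δ δ' : ℝ} (hδ : δ ≤ 1 / 100) (hδ' : δ' ≤ 1 / 100)
    (hclose : ∀ i k, dist (U i) (U k) < 1 / 10000) (h2 : 2 / 10000 ≤ δ) (h2' : 2 / 10000 ≤ δ') :
    fedM δ (fun j => (U j).val) = fedM δ' (fun j => (U j).val) := by
  have hU := guard_of_dist_lt hclose (show 2 * (1 / 10000 : ℝ) ≤ δ by linarith)
  have hU' := guard_of_dist_lt hclose (show 2 * (1 / 10000 : ℝ) ≤ δ' by linarith)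
  have h := isPureAverage_fedM hδ hU hclose
  exact (val_eq_fedM_of_isPureAverage hδ' hU' hclose h).symm ▸ rfl

end BalabanToPure

/-! ## §4 Group level, `G = U(N)`: the `GroupAverage` inhabitant `federbushU` is the pure average -/

section GroupU

variable {m : ℕ}

/-- The carrier identification `U(N) ≃* UN N` (p12's `UN.ofUnitaryGroup`, `val`-preserving), recorded as a group isomorphism.
[cite: Federbush1987PhaseCellIII, §1 p. 294] -/
def equivUN : ↥(Matrix.unitaryGroup (Fin N) ℂ) ≃* UN N where
  toFun := UN.ofUnitaryGroup
  invFun U := ⟨U.val, U.mem⟩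
  left_inv _ := rfl
  right_inv _ := rfl
  map_mul' _ _ := rfl

/-- `equivUN u = UN.ofUnitaryGroup u`. [cite: Federbush1987PhaseCellIII, §1 p. 294] -/
@[simp] theorem equivUN_apply (u : Matrix.unitaryGroup (Fin N) ℂ) : equivUN u = UN.ofUnitaryGroup u := rfl

/-- `(equivUN u).val = u`. [cite: Federbush1987PhaseCellIII, §1 p. 294] -/
@[simp] theorem equivUN_val (u : Matrix.unitaryGroup (Fin N) ℂ) : (equivUN u).val = (u : Matrix (Fin N) (Fin N) ℂ) := rfl

/-- `(UN.ofUnitaryGroup u).val = u`. [cite: Federbush1987PhaseCellIII, §1 p. 294] -/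
@[simp] theorem ofUnitaryGroup_val (u : Matrix.unitaryGroup (Fin N) ℂ) :
    (UN.ofUnitaryGroup u).val = (u : Matrix (Fin N) (Fin N) ℂ) := rfl

variable [NeZero N]

/-- **The guard of `federbushU` is automatic in Regime 1**: a `U(N)`-family of pairwise length distance `< 10⁻⁴` is
`FamilySmall (1/100)` (`dist1 (U_i U_k⁻¹) = |U_i U_k* − 1| ≤ 2·10⁻⁴`). [cite: Balaban1987RG1, (0.10) p.253] -/
theorem familySmall_federbushU_of_dist_lt {U : Fin (m + 1) → Matrix.unitaryGroup (Fin N) ℂ}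
    (hclose : ∀ i k, dist (UN.ofUnitaryGroup (U i)) (UN.ofUnitaryGroup (U k)) < 1 / 10000) :
    FamilySmall (federbushU (n := Fin N)).δ U := by
  rw [federbushU_δ, familySmall_U_iff]
  exact guard_of_dist_lt (U := fun j => UN.ofUnitaryGroup (U j)) hclose (by norm_num)

/-- **`federbushU.M U` IS the Federbush pure average (1.2)** of the family (read in `UN N`), for every `U(N)`-family `U₀, …, U_m`
of pairwise length distance `< 10⁻⁴`: the `Setup.GroupAverage` inhabitant of B12 (0.10) and Federbush's minimiser coincide.
[cite: Balaban1987RG1, (0.10) p.253] [cite: Federbush1987PhaseCellIII, (1.1)–(1.2) p. 294–295] -/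
theorem isPureAverage_federbushU {U : Fin (m + 1) → Matrix.unitaryGroup (Fin N) ℂ}
    (hclose : ∀ i k, dist (UN.ofUnitaryGroup (U i)) (UN.ofUnitaryGroup (U k)) < 1 / 10000) :
    IsPureAverage (fun j => UN.ofUnitaryGroup (U j)) (UN.ofUnitaryGroup ((federbushU (n := Fin N)).M U)) := by
  have hU := guard_of_dist_lt (U := fun j => UN.ofUnitaryGroup (U j)) hclose (show 2 * (1 / 10000 : ℝ) ≤ 1 / 100 by norm_num)
  have h := isPureAverage_fedM (U := fun j => UN.ofUnitaryGroup (U j)) le_rfl hU hclose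
  have e : UN.ofUnitaryGroup ((federbushU (n := Fin N)).M U)
      = UN.ofUnitaryGroup ⟨fedM (1 / 100) (fun j => (UN.ofUnitaryGroup (U j)).val),
          fedM_mem_unitaryGroup (fun j => (UN.ofUnitaryGroup (U j)).mem) le_rfl⟩ := UN.ext rfl
  rw [e]; exact h

/-- **Every pure average is `federbushU.M U`** (same hypotheses): uniqueness side. [cite: Balaban1987RG1, (0.10) p.253]
[cite: Federbush1987PhaseCellIII, (1.1)–(1.2), Proposition 5.9 p. 294–295, 301] -/
theorem federbushU_eq_of_isPureAverage {U : Fin (m + 1) → Matrix.unitaryGroup (Fin N) ℂ} {gbar : UN N}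
    (hclose : ∀ i k, dist (UN.ofUnitaryGroup (U i)) (UN.ofUnitaryGroup (U k)) < 1 / 10000)
    (hbar : IsPureAverage (fun j => UN.ofUnitaryGroup (U j)) gbar) :
    UN.ofUnitaryGroup ((federbushU (n := Fin N)).M U) = gbar :=
  (UN.existsUnique_isPureAverage (Nat.succ_pos m) _ hclose).unique (isPureAverage_federbushU hclose) hbar

/-- The pure average of a Regime-1 `U(N)`-family EXISTS UNIQUELY and is `federbushU.M U`. [cite: Balaban1987RG1, (0.10) p.253]
[cite: Federbush1987PhaseCellIII, (1.1)–(1.2) p. 294–295] -/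
theorem existsUnique_isPureAverage_eq_federbushU {U : Fin (m + 1) → Matrix.unitaryGroup (Fin N) ℂ}
    (hclose : ∀ i k, dist (UN.ofUnitaryGroup (U i)) (UN.ofUnitaryGroup (U k)) < 1 / 10000) :
    (∃! gbar : UN N, IsPureAverage (fun j => UN.ofUnitaryGroup (U j)) gbar) ∧
      ∀ gbar : UN N, IsPureAverage (fun j => UN.ofUnitaryGroup (U j)) gbar ↔
        gbar = UN.ofUnitaryGroup ((federbushU (n := Fin N)).M U) :=
  ⟨UN.existsUnique_isPureAverage (Nat.succ_pos m) _ hclose, fun _ =>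
    ⟨fun h => (federbushU_eq_of_isPureAverage hclose h).symm, fun h => h ▸ isPureAverage_federbushU hclose⟩⟩

end GroupU

/-! ## §5 `G = SU(N)`: `federbushSU` is the pure average in `SU(N)` -/

section GroupSU

variable {m : ℕ}

/-- The carrier identification on objects: a special unitary matrix read in p32 g8's `SUN N = {det = 1} ≤ UN N`.
[cite: Federbush1987PhaseCellIII, §1 p. 294] -/
def toSUN (u : Matrix.specialUnitaryGroup (Fin N) ℂ) : SUN N :=
  ⟨UN.ofUnitaryGroup ⟨(u : Matrix (Fin N) (Fin N) ℂ), u.2.1⟩, (UN.mem_special_iff (N := N)).mpr u.2.2⟩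

/-- `(toSUN u).1.val = u`. [cite: Federbush1987PhaseCellIII, §1 p. 294] -/
@[simp] theorem toSUN_val (u : Matrix.specialUnitaryGroup (Fin N) ℂ) : (toSUN u).1.val = (u : Matrix (Fin N) (Fin N) ℂ) := rfl

/-- `SU(N) ≃* SUN N`, `val`-preserving. [cite: Federbush1987PhaseCellIII, §1 p. 294] -/
def equivSUN : ↥(Matrix.specialUnitaryGroup (Fin N) ℂ) ≃* SUN N where
  toFun := toSUN
  invFun a := ⟨a.1.val, a.1.mem, (UN.mem_special_iff (N := N)).mp a.2⟩
  left_inv _ := rfl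
  right_inv _ := rfl
  map_mul' _ _ := rfl

/-- `equivSUN u = toSUN u`. [cite: Federbush1987PhaseCellIII, §1 p. 294] -/
@[simp] theorem equivSUN_apply (u : Matrix.specialUnitaryGroup (Fin N) ℂ) : equivSUN u = toSUN u := rfl

/-- The `SU(N)` Regime-1 radius of p32 g8 (`min(10⁻⁴, min(1/100, 1/(N+1))/8)`) is below `10⁻⁴`. [cite: Federbush1987PhaseCellIII,
Proposition 5.9 (5.16) p. 301] -/
theorem radiusSU_le : min (1 / 10000 : ℝ) (min (1 / 100) (1 / ((N : ℝ) + 1)) / 8) ≤ 1 / 10000 := min_le_left _ _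

/-- Twice the `SU(N)` Regime-1 radius is below Bałaban's `SU(N)` guard `δ_N = min(1/100, 1/(3N))` (`N ≥ 1`).
[cite: Balaban1987RG1, (0.9)–(0.10) p.253] -/
theorem two_mul_radiusSU_le_deltaFed [NeZero N] :
    2 * min (1 / 10000 : ℝ) (min (1 / 100) (1 / ((N : ℝ) + 1)) / 8) ≤ deltaFed (Fin N) := by
  have hN : (1 : ℝ) ≤ N := by exact_mod_cast Nat.one_le_iff_ne_zero.mpr (NeZero.ne N)
  have hN0 : (0 : ℝ) < N := by linarith
  rw [deltaFed, Fintype.card_fin]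
  refine le_min ?_ ?_
  · linarith [min_le_left (1 / 10000 : ℝ) (min (1 / 100) (1 / ((N : ℝ) + 1)) / 8)]
  · have h1 : min (1 / 10000 : ℝ) (min (1 / 100) (1 / ((N : ℝ) + 1)) / 8) ≤ (1 / ((N : ℝ) + 1)) / 8 :=
      (min_le_right _ _).trans (div_le_div_of_nonneg_right (min_le_right _ _) (by norm_num))
    have h2 : 2 * ((1 / ((N : ℝ) + 1)) / 8) ≤ 1 / (3 * N) := by
      rw [show 2 * ((1 / ((N : ℝ) + 1)) / 8) = 1 / (4 * ((N : ℝ) + 1)) by field_simp; ring]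
      exact one_div_le_one_div_of_le (by positivity) (by nlinarith)
    linarith

variable [NeZero N]

open scoped Matrix.Norms.L2Operator in
/-- **The guard of `federbushSU` is automatic in Regime 1** for an `SU(N)`-family of pairwise distance below p32 g8's radius.
[cite: Balaban1987RG1, (0.10) p.253] -/
theorem familySmall_federbushSU_of_dist_lt {U : Fin (m + 1) → Matrix.specialUnitaryGroup (Fin N) ℂ}
    (hclose : ∀ i k, dist (toSUN (U i)) (toSUN (U k)) < min (1 / 10000 : ℝ) (min (1 / 100) (1 / ((N : ℝ) + 1)) / 8)) :
    FamilySmall (federbushSU (n := Fin N)).δ U := by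
  rw [federbushSU_δ, familySmall_SU_iff]
  have h := guard_of_dist_lt (U := fun j => (toSUN (U j)).1) (fun i k => hclose i k) two_mul_radiusSU_le_deltaFed
  exact h

open scoped Matrix.Norms.L2Operator in
/-- **Every pure average IN `SU(N)` is `federbushSU.M U`**: for an `SU(N)`-family `U₀, …, U_m` of pairwise length distance
`< min(10⁻⁴, min(1/100, 1/(N+1))/8)`, a minimiser `ḡ ∈ SU(N)` of (1.2) over `SU(N)` is a `U(N)`-pure average (p32 g8
`SUN.isPureAverage_coe_of_pairwise`), hence (§2, guard `δ_N`) `ḡ = fedM δ_N U = federbushSU.M U`. [cite: Balaban1987RG1, (0.10) p.253]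
[cite: Federbush1987PhaseCellIII, (1.1)–(1.2) p. 294–295] -/
theorem federbushSU_eq_of_isPureAverage {U : Fin (m + 1) → Matrix.specialUnitaryGroup (Fin N) ℂ} {gbar : SUN N}
    (hclose : ∀ i k, dist (toSUN (U i)) (toSUN (U k)) < min (1 / 10000 : ℝ) (min (1 / 100) (1 / ((N : ℝ) + 1)) / 8))
    (hbar : IsPureAverage (fun j => toSUN (U j)) gbar) : toSUN ((federbushSU (n := Fin N)).M U) = gbar := by
  have hcoe := SUN.isPureAverage_coe_of_pairwise hbar hclose (min_le_right _ _)
  have hclose' : ∀ i k, dist (toSUN (U i)).1 (toSUN (U k)).1 < 1 / 10000 := fun i k =>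
    (hclose i k).trans_le radiusSU_le
  have hU := guard_of_dist_lt (U := fun j => (toSUN (U j)).1) (fun i k => hclose i k) two_mul_radiusSU_le_deltaFed
  have h := val_eq_fedM_of_isPureAverage (U := fun j => (toSUN (U j)).1) deltaFed_le hU hclose' hcoe
  apply Subtype.ext; apply UN.ext
  rw [h]; rfl

/-- **`federbushSU.M U` IS the Federbush pure average IN `SU(N)`** of every such `SU(N)`-family (existence of a minimiser in the
compact `SU(N)`, `SUN.exists_isPureAverage`, + the previous theorem). [cite: Balaban1987RG1, (0.9)–(0.10) p.253]
[cite: Federbush1987PhaseCellIII, (1.1)–(1.2) p. 294–295] -/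
theorem isPureAverage_federbushSU {U : Fin (m + 1) → Matrix.specialUnitaryGroup (Fin N) ℂ}
    (hclose : ∀ i k, dist (toSUN (U i)) (toSUN (U k)) < min (1 / 10000 : ℝ) (min (1 / 100) (1 / ((N : ℝ) + 1)) / 8)) :
    IsPureAverage (fun j => toSUN (U j)) (toSUN ((federbushSU (n := Fin N)).M U)) := by
  obtain ⟨gbar, hbar⟩ := SUN.exists_isPureAverage (fun j => toSUN (U j))
  rw [federbushSU_eq_of_isPureAverage hclose hbar]; exact hbar

/-- The pure average in `SU(N)` of a Regime-1 `SU(N)`-family EXISTS UNIQUELY and is `federbushSU.M U`.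
[cite: Balaban1987RG1, (0.9)–(0.10) p.253] [cite: Federbush1987PhaseCellIII, (1.1)–(1.2) p. 294–295] -/
theorem existsUnique_isPureAverage_eq_federbushSU {U : Fin (m + 1) → Matrix.specialUnitaryGroup (Fin N) ℂ}
    (hclose : ∀ i k, dist (toSUN (U i)) (toSUN (U k)) < min (1 / 10000 : ℝ) (min (1 / 100) (1 / ((N : ℝ) + 1)) / 8)) :
    (∃! gbar : SUN N, IsPureAverage (fun j => toSUN (U j)) gbar) ∧
      ∀ gbar : SUN N, IsPureAverage (fun j => toSUN (U j)) gbar ↔ gbar = toSUN ((federbushSU (n := Fin N)).M U) :=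
  ⟨SUN.existsUnique_isPureAverage (Nat.succ_pos m) _ hclose, fun _ =>
    ⟨fun h => (federbushSU_eq_of_isPureAverage hclose h).symm, fun h => h ▸ isPureAverage_federbushSU hclose⟩⟩

/-- For an `SU(N)`-family in Regime 1 the `U(N)`-average and the `SU(N)`-average of B12 agree as matrices (both are the unique
`U(N)`-pure average; cf. `fedM_mem_specialUnitaryGroup`). [cite: Balaban1987RG1, (0.9)–(0.10) p.253] -/
theorem federbushSU_coe_eq_federbushU {U : Fin (m + 1) → Matrix.specialUnitaryGroup (Fin N) ℂ}
    (hclose : ∀ i k, dist (toSUN (U i)) (toSUN (U k)) < min (1 / 10000 : ℝ) (min (1 / 100) (1 / ((N : ℝ) + 1)) / 8)) :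
    (((federbushSU (n := Fin N)).M U : Matrix.specialUnitaryGroup (Fin N) ℂ) : Matrix (Fin N) (Fin N) ℂ)
      = (((federbushU (n := Fin N)).M (fun j => ⟨(U j : Matrix (Fin N) (Fin N) ℂ), (U j).2.1⟩) :
          Matrix.unitaryGroup (Fin N) ℂ) : Matrix (Fin N) (Fin N) ℂ) := by
  have hclose' : ∀ i k, dist (toSUN (U i)).1 (toSUN (U k)).1 < 1 / 10000 := fun i k =>
    (hclose i k).trans_le radiusSU_le
  have hSU := isPureAverage_federbushSU hclose
  have hcoe := SUN.isPureAverage_coe_of_pairwise hSU hclose (min_le_right _ _)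
  have hU := federbushU_eq_of_isPureAverage (U := fun j => ⟨(U j : Matrix (Fin N) (Fin N) ℂ), (U j).2.1⟩) hclose' hcoe
  have := congrArg UN.val hU
  simpa using this.symm

end GroupSU

/-! ## §6 (v1.1) VI p. 19 «This yields "Balaban averaging."» — the block-spin function of VI is the (0.10) average -/

section BlockSpin

variable {B : UNBlockSpinFunction N} {gs : Fin 16 → UN N}

/-- Sixteen data within `min(ε, 1/20000)` of the identity are pairwise `10⁻⁴`-close. [cite: Federbush1987PhaseCellVI, property 2)
(3)–(4) p. 19] -/
theorem UNBlockSpinFunction.dist_lt_of_absG_lt (hgs : ∀ x, absG (gs x) < min B.ε (1 / 20000)) (i k : Fin 16) :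
    dist (gs i) (gs k) < 1 / 10000 := by
  have hi := (hgs i).trans_le (min_le_right _ _)
  have hk := (hgs k).trans_le (min_le_right _ _)
  rw [absG_def] at hi hk
  calc dist (gs i) (gs k) ≤ dist (gs i) 1 + dist 1 (gs k) := dist_triangle _ _ _
    _ < 1 / 20000 + 1 / 20000 := by rw [dist_comm]; exact add_lt_add hi hk
    _ = 1 / 10000 := by norm_num

open scoped Matrix.Norms.L2Operator in
/-- **«The function as specified for "small" g in (2) above, yields "Balaban averaging."»** (VI p. 19): every admissible
block-spin function `Φ` of Federbush's VI scheme on `U(N)` (property 2): a pure average on `ε`-small data) coincides, on data of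
size `< min(ε, 1/20000)`, with Bałaban's (0.10) average `fedM δ` for every admissible guard `δ ≤ 1/100`.
[cite: Federbush1987PhaseCellVI, properties 1)–2) (3)–(4) p. 18–19] [cite: Balaban1987RG1, (0.10) p.253] -/
theorem UNBlockSpinFunction.Φ_val_eq_fedM (hgs : ∀ x, absG (gs x) < min B.ε (1 / 20000)) {δ : ℝ} (hδ : δ ≤ 1 / 100)
    (hU : ∀ i k, ‖(gs i).val * star (gs k).val - 1‖ < δ) :
    (B.Φ gs).val = fedM δ (fun j => (gs j).val) :=
  val_eq_fedM_of_isPureAverage (m := 15) hδ hU (UNBlockSpinFunction.dist_lt_of_absG_lt hgs)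
    (B.pure gs fun x => (hgs x).trans_le (min_le_left _ _))

variable [NeZero N]

/-- The same at group level: `Φ(g_{Γ_x}) = federbushU.M (g_{Γ_x})` — the `Setup.GroupAverage` inhabitant of B12 (0.10) IS the
block-spin transformation of VI on small data. [cite: Federbush1987PhaseCellVI, properties 1)–2) (3)–(4) p. 18–19]
[cite: Balaban1987RG1, (0.10) p.253] -/
theorem UNBlockSpinFunction.Φ_eq_federbushU (hgs : ∀ x, absG (gs x) < min B.ε (1 / 20000)) :
    B.Φ gs = UN.ofUnitaryGroup ((federbushU (n := Fin N)).M (fun j => (⟨(gs j).val, (gs j).mem⟩ : Matrix.unitaryGroup (Fin N) ℂ))) :=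
  (federbushU_eq_of_isPureAverage (m := 15) (U := fun j => ⟨(gs j).val, (gs j).mem⟩)
    (UNBlockSpinFunction.dist_lt_of_absG_lt hgs) (B.pure gs fun x => (hgs x).trans_le (min_le_left _ _))).symm

/-- Hence ALL admissible block-spin functions of VI agree on data of size `< min(ε, ε′, 1/20000)` («We use the same function to
define all such transformations», VI p. 19 — here: there is only one). [cite: Federbush1987PhaseCellVI, properties 1)–2) (3)–(4) p. 18–19] -/
theorem UNBlockSpinFunction.Φ_eq_Φ {B' : UNBlockSpinFunction N} (hgs : ∀ x, absG (gs x) < min B.ε (1 / 20000))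
    (hgs' : ∀ x, absG (gs x) < min B'.ε (1 / 20000)) : B.Φ gs = B'.Φ gs := by
  rw [UNBlockSpinFunction.Φ_eq_federbushU hgs, UNBlockSpinFunction.Φ_eq_federbushU hgs']

end BlockSpin

end

end FederbushMean

end Literature.MathematicalPhysics.QuantumFieldTheory.Balaban1983to89
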